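import Literature.NumberTheory.Automorphic.Liu2021.Lemma24OfJacobianDimension
import Literature.AlgebraicGeometry.Motives.JacobianBaseChangeSurjective
import Literature.AlgebraicGeometry.Motives.JacobianOfIso
import Literature.AlgebraicGeometry.Motives.AbelianVarietyEpiTateSurjective
import Literature.AlgebraicGeometry.Motives.AbelianVarietySimpleFactorsUnique
import Literature.AlgebraicGeometry.Milne1999.CMTypeSubquotients
import HarnessLib

/-!
# The complex Albanese variety of `X / k` is of CM-type when the Albanese varieties of the complex pieces of `X ⊗_k ℂ` are

[Liu2021] = Yifeng Liu, *Fourier–Jacobi cycles and arithmetic relative trace formula*, Camb. J. Math. **9** (2021) =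
arXiv:2102.11518.  Cell `hodgecm-mathlib` (D-0151), capital for row VI-1 of the `hLiu418` cone (the Faltings isotypic step
[Liu2021, Thm. 4.18 proof l. 2245–2263] consumes Faltings' theorem only at pairs `(Alb(X_K), A_μ)`; for pairs of CM-type it
is a theorem of the tree, `faltings_tate_bijective_of_isOfCMType`).  This file supplies the GENERIC half of the Albanese side:

* `isOfCMType_of_split` — a complex abelian variety `B` SPLIT by finitely many abelian varieties of CM-type (homomorphisms
  `π_c : B → J_c`, `i_c : J_c → B` with `Σ_c π_c ≫ i_c = 𝟙_B`) is of CM-type: `B` is a quotient of the product `Π_c J_c`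
  ([Milne1999, §2 p. 54]: the CM-type class is closed under products and quotients).
* `Albanese.isOfCMType_baseChange_complex_of_pieces` — for `X / k` projective and smooth over a characteristic-zero field
  `k ⊆ ℂ`, a Liu Albanese datum `a` of `X` ([Liu2021, Def. 2.3]) and a colimit cofan `inj_q : Y_q ⟶ X ⊗_k ℂ` of geometrically
  irreducible complex pieces: if every Albanese variety (`Jacobian`, Milne's difference-map form) of every piece `Y_q` is of
  CM-type, then `Alb_X ⊗_k ℂ` is of CM-type.  PROOF: the α-compatible Albanese fan over a finite Galois level read over `ℂ`
  ([Liu2021, §2.1 Proposition with proof, Lemma 2.4 (1) proof l. 1220–1228]; the tree's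
  `Albanese.exists_isGalois_split_baseChange_complex_compat_abstract`) splits `Alb_X ⊗_k ℂ` by the `J(E_c) ⊗_L ℂ`; each
  `E_c ⊗_L ℂ` is one of the `Y_q` (`exists_bijective_iso_pieces`), so `J(E_c ⊗_L ℂ)` is of CM-type (Albanese varieties of
  isomorphic schemes are isomorphic, `Jacobian.nonempty_iso_J_of_iso`), and `J(E_c ⊗_L ℂ) ↠ J(E_c) ⊗_L ℂ`
  ([Milne1986JacobianVarieties, §6 Prop. 6.1/6.4]; `Jacobian.exists_hom_baseChange_surjective`) makes `J(E_c) ⊗_L ℂ` of CM-type.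

Theorems only; no definition, no named fact; binder shape of the head = `albanese_bettiOne_pullback_bijective_of_isProjectiveOver`
with the Betti inequality replaced by the CM hypothesis.  HC_CM is proved only modulo the 7 printed citations until rung 0 closes;
this file changes no count.

## References
* [Liu2021] Y. Liu, arXiv:2102.11518 = Camb. J. Math. 9 (2021): §2.1 Proposition (FJcycle.tex l. 1190–1200), Def. 2.3, Lemma 2.4 (1)
  with proof (l. 1210–1228); Thm. 4.18 proof (l. 2245–2263).
* [Milne1999] J. S. Milne, *Lefschetz motives and the Tate conjecture*, Compositio Math. 117 (1999), §2 p. 54.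
* [Milne1986JacobianVarieties] J. S. Milne, *Jacobian varieties*, in: Arithmetic Geometry (1986), §6 Prop. 6.1, Prop. 6.4, Remark 6.5.
* [MumfordAV1970] D. Mumford, *Abelian Varieties* (1970), §19 Thm. 1 and Remark p. 169.
-/

noncomputable section

open CategoryTheory CategoryTheory.Limits AlgebraicGeometry MonoidalCategory CartesianMonoidalCategory
open Literature.AlgebraicGeometry.Motives Literature.AlgebraicGeometry.Milne1999

namespace Literature.NumberTheory.Automorphic.Liu2021.AppendixC

open AbelianVariety (bcSpec bcFunctor)

set_option backward.isDefEq.respectTransparency false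

/-! ## §1 A split by abelian varieties of CM-type -/

/-- **A complex abelian variety split by abelian varieties of CM-type is of CM-type.**  If `π_c : B → J_c` and
`i_c : J_c → B` (`c` in a finite index type) satisfy `Σ_c π_c ≫ i_c = 𝟙_B` and every `J_c` is of CM-type, then `B` is of
CM-type: the homomorphism `Σ_c pr_c ≫ i_c : Π_c J_c → B` out of the product (of CM-type, [Milne1999] §2) has the section
`(π_c)_c`, hence is a (split) epimorphism, hence surjective ([MumfordAV1970] §19), and quotients of CM-type abelian varieties are
of CM-type. [cite: Milne1999, §2 p. 54] [cite: MumfordAV1970, §19 Thm. 1 and Remark p. 169] -/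
theorem isOfCMType_of_split {C : Type} [Fintype C] (B : AbelianVariety ℂ) (J : C → AbelianVariety ℂ)
    (π : ∀ c, B ⟶ J c) (i : ∀ c, J c ⟶ B) (htot : ∑ c, π c ≫ i c = 𝟙 B) (hJ : ∀ c, IsOfCMType (J c)) :
    IsOfCMType B := by
  classical
  by_cases hC : Nonempty C
  swap
  · -- no pieces: `𝟙_B = 0`, so `B` is the zero abelian variety
    haveI : IsEmpty C := not_nonempty_iff.mp hC
    have h0 : 𝟙 B = 0 := by rw [← htot]; exact Fintype.sum_empty _
    have hdim : B.dim = 0 := by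
      by_contra h
      exact AbelianVariety.id_ne_zero_of_dim_pos (Nat.pos_of_ne_zero h) h0
    exact isOfCMType_of_dim_eq_zero hdim
  obtain ⟨c₀⟩ := hC
  -- the product `Π_{c ∈ s} J_c` with its projections, built by induction on `s` (no definition needed: we only keep its
  -- CM-type, its projections `p_c` — zero off `s` — and the pairing property)
  have key : ∀ s : Finset C, ∃ (P : AbelianVariety ℂ), IsOfCMType P ∧ ∃ p : ∀ c, P ⟶ J c, (∀ c, c ∉ s → p c = 0) ∧
      ∀ (T : AbelianVariety ℂ) (f : ∀ c, T ⟶ J c), ∃ g : T ⟶ P, ∀ c ∈ s, g ≫ p c = f c := by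
    intro s
    induction s using Finset.induction_on with
    | empty => exact ⟨J c₀, hJ c₀, fun _ => 0, fun _ _ => rfl, fun T _ => ⟨0, fun _ h => absurd h (Finset.notMem_empty _)⟩⟩
    | insert a s ha ih =>
      obtain ⟨P, hP, p, hp0, hlift⟩ := ih
      refine ⟨(J a).prod P, (hJ a).prod hP,
        Function.update (fun c => AbelianVariety.snd (J a) P ≫ p c) a (AbelianVariety.fst (J a) P), ?_, ?_⟩
      · intro c hc
        have hca : c ≠ a := fun h => hc (h ▸ Finset.mem_insert_self a s)
        rw [Function.update_of_ne hca, hp0 c (fun h => hc (Finset.mem_insert_of_mem h)), comp_zero]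
      · intro T f
        obtain ⟨g, hg⟩ := hlift T f
        refine ⟨AbelianVariety.prodLift (f a) g, fun c hc => ?_⟩
        by_cases hca : c = a
        · subst hca
          rw [Function.update_self, AbelianVariety.prodLift_fst]
        · rw [Function.update_of_ne hca, ← Category.assoc, AbelianVariety.prodLift_snd,
            hg c ((Finset.mem_insert.mp hc).resolve_left hca)]
  obtain ⟨P, hP, p, -, hlift⟩ := key Finset.univ
  obtain ⟨g, hg⟩ := hlift B π
  -- `r := Σ_c p_c ≫ i_c : P → B` has the section `g`
  let r : P ⟶ B := ∑ c, p c ≫ i c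
  have hgr : g ≫ r = 𝟙 B := by
    simp only [r, Preadditive.comp_sum, ← Category.assoc]
    rw [← htot]
    exact Finset.sum_congr rfl fun c _ => by rw [hg c (Finset.mem_univ c)]
  haveI : IsSplitEpi r := IsSplitEpi.mk' ⟨g, hgr⟩
  exact isOfCMType_of_surjective_hom r (AbelianVariety.surjective_toSchemeHom_of_epi r) hP

/-! ## §2 The Albanese variety of `X ⊗_k ℂ` from the Albanese varieties of the complex pieces -/

/-- **The complex Albanese variety of a smooth projective `X / k` is of CM-type when the Albanese varieties of the complex
pieces are.**  For `X / k` projective and smooth of relative dimension `d` over a characteristic-zero field `k ⊆ ℂ`, a Liu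
Albanese datum `a` of `X` ([Liu2021] Def. 2.3) and a colimit cofan `inj_q : Y_q ⟶ X ⊗_k ℂ` of geometrically irreducible complex
pieces: if every Albanese variety `𝒥.J` of every piece `Y_q` is of CM-type, then `Alb_X ⊗_k ℂ` is of CM-type.  The fan of
[Liu2021] §2.1 / Lemma 2.4 (1) (proof) read over `ℂ` (`Albanese.exists_isGalois_split_baseChange_complex_compat_abstract`)
splits `Alb_X ⊗_k ℂ` by the `J(E_c) ⊗_L ℂ`, each a quotient of `J(E_c ⊗_L ℂ) ≅ J(Y_{q(c)})`
([Milne1986JacobianVarieties] §6); conclude by `isOfCMType_of_split`.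
[cite: Liu2021, §2.1 Proposition (FJcycle.tex l. 1190–1200) and Lemma 2.4 (1) proof (l. 1220–1228)]
[cite: Milne1986JacobianVarieties, §6 Prop. 6.1, Prop. 6.4 and Remark 6.5] [cite: Milne1999, §2 p. 54] -/
theorem Albanese.isOfCMType_baseChange_complex_of_pieces {k : Type} [Field k] [CharZero k] [Algebra k ℂ] {d : ℕ}
    (X : SchemeOver k) [SmoothOfRelativeDimension d X.hom] (hX : IsProjectiveOver X) (a : Albanese X)
    {Ξ : Type} (Y : Ξ → SchemeOver ℂ) [∀ q, GeometricallyIrreducible (Y q).hom]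
    (inj : ∀ q, Y q ⟶ (bcFunctor k ℂ).obj X) (hcol : IsColimit (Cofan.mk ((bcFunctor k ℂ).obj X) inj))
    (hCM : ∀ (q : Ξ) (𝒥 : Jacobian (Y q)), IsOfCMType 𝒥.J) :
    IsOfCMType (a.Alb.baseChange ℂ) := by
  classical
  -- the α-compatible Albanese fan over a finite Galois level, read over `ℂ`
  obtain ⟨L, _, _, _, _, _, -, eX, -, -, C, _, E, e, hE, ⟨hcolL⟩, P, 𝒥, πℂ, ιℂ, -, -, -, htot, -, -⟩ :=
    Albanese.exists_isGalois_split_baseChange_complex_compat_abstract (d := d) X hX a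
  -- matching of the pieces `E_c ⊗_L ℂ ≅ Y_{q c}`
  obtain ⟨q, φ, -, -⟩ := exists_bijective_iso_pieces (d := d) X eX E e hE hcolL Y inj hcol
  refine isOfCMType_of_split (a.Alb.baseChange ℂ) (fun c => (𝒥 c).J.baseChange ℂ) πℂ ιℂ htot fun c => ?_
  -- `J(E_c ⊗_L ℂ)` is of CM-type: it is isomorphic to an Albanese variety of `Y_{q c}`
  have hEℂ : IsSmoothProjective d ((bcFunctor L ℂ).obj (E c)) := (hE c).baseChange_obj ℂ
  obtain ⟨𝒥'⟩ := nonempty_jacobian_of_isSmoothProjective_complex_of_dim _ hEℂ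
  obtain ⟨𝒥Y⟩ := Jacobian.nonempty_of_iso ⟨𝒥'⟩ (φ c)
  obtain ⟨jj⟩ := 𝒥'.nonempty_iso_J_of_iso 𝒥Y (φ c)
  have h𝒥' : IsOfCMType 𝒥'.J :=
    isOfCMType_of_surjective_hom jj.hom (AbelianVariety.surjective_toSchemeHom_of_epi jj.hom) (hCM (q c) 𝒥Y)
  -- … and maps onto `J(E_c) ⊗_L ℂ`
  haveI : IsProper (E c).hom := (hE c).isProper_holds
  haveI : GeometricallyIntegral (E c).hom := (hE c).geometricallyIntegral_holds
  obtain ⟨u, -, hu⟩ := Jacobian.exists_hom_baseChange_surjective ℂ (𝒥 c) 𝒥' (P c)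
  exact isOfCMType_of_surjective_hom u hu h𝒥'

end Literature.NumberTheory.Automorphic.Liu2021.AppendixC

end
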